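import Literature.MathematicalPhysics.QuantumManyBody.DiluteBoseGasUpperBoundLocalization
import HarnessLib

/-!
# The Basti–Cenatiempo–Schlein cut-off state as a named object

Topic `Literature/MathematicalPhysics/QuantumManyBody`; a thin naming layer over
`DiluteBoseGasUpperBoundLocalization.lean` ([BastiCenatiempoSchlein2021, App. A, Lemma A.1]),
where the localisation `Ψ ↦ Ψ(· + u) ∏_{i,k} q(x_{ik})` of an `L`-periodic `N`-body wave function
into the Dirichlet box `Λ_{L+2ℓ}` is manipulated as a raw lambda throughout. Users downstream
(occupation / density-matrix transport of the cut-off state, crux line `reward-pays-the-wall` of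
`AtomisticToContinuum/BoseEinsteinCondensation`) need to quantify over the cut-off profile and to
hold the resulting Dirichlet trial state as a term, hence:

* `cutoffFun q u ψ` — the cut-off wave function (definitionally the lambda of the source file);
* `IsCutoffProfile q ℓ L D` — hypothesis structure bundling the six properties of the profile
  delivered by `exists_smooth_cutoff` (`C¹`, values in `[0,1]`, support in `(0, L+2ℓ)`, the exact
  partition of unity `∑_m q(t - Lm)² = 1` behind (A.3), slope bound `D`, slope supported on the
  two ramps); `exists_isCutoffProfile` repackages `exists_smooth_cutoff` (`D = c/ℓ`);
* `cutoffTrialState hL hq Ψ u : TrialState N (L + 2ℓ)` — the cut-off state of a periodic trial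
  state IS an admissible Dirichlet trial state: `C¹` (`contDiff_cutoffState`), supported in the box
  (`mem_box_of_cutoffState_ne_zero`), Bose-symmetric (`cutoffState_comp_perm`) and normalised
  (`lintegral_ennnorm_cutoffState_sq`, i.e. `‖Ψ^D‖ = 1` of Lemma A.1);
* `energy_cutoffTrialState_le_eta` — the energy bound of `energyIntegral_cutoffState_le_eta`
  restated for the named state (same right-hand side).

Nothing new is proved here beyond repackaging; the energy bound for a single shift with explicit
ramp multiplicity, and the transport of one-particle density matrices (`γ ↦ QγQ`), are separate
files.
-/

noncomputable section

open MeasureTheory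
open scoped ENNReal NNReal

namespace Literature.MathematicalPhysics.QuantumManyBody.BoseGas

variable {N : ℕ}

/-- The **cut-off of a torus wave function** at shift `u` with profile `q`:
`Φ_u(X) = ψ(X + u) ∏_{i,k} q(x_{ik})` — verbatim the function of
`lintegral_ennnorm_cutoffState_sq` / `energyIntegral_cutoffState_le`.
[cite: BastiCenatiempoSchlein2021, App. A, (A.1)] -/
def cutoffFun (q : ℝ → ℝ) (u : Space) (ψ : Config N → ℂ) (X : Config N) : ℂ :=
  ψ (X + fun _ => u) * ((∏ p : Fin N × Fin 3, q (X p.1 p.2) : ℝ) : ℂ)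

/-- `cutoffFun` unfolds to the raw lambda of the source file. [folklore] -/
theorem cutoffFun_apply (q : ℝ → ℝ) (u : Space) (ψ : Config N → ℂ) (X : Config N) :
    cutoffFun q u ψ X = ψ (X + fun _ => u) * ((∏ p : Fin N × Fin 3, q (X p.1 p.2) : ℝ) : ℂ) :=
  rfl

/-- **Admissible cut-off profile** on the period `L` with ramps of width `2ℓ` and slope bound `D`:
the six properties delivered by `exists_smooth_cutoff`. [cite: BastiCenatiempoSchlein2021, App. A, Lemma A.1 (the cut-off `q_{L,ℓ}` and (A.3))] -/
structure IsCutoffProfile (q : ℝ → ℝ) (ℓ L D : ℝ) : Prop where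
  /-- `q` is `C¹`. -/
  contDiff : ContDiff ℝ 1 q
  /-- `0 ≤ q ≤ 1`. -/
  range : ∀ t, 0 ≤ q t ∧ q t ≤ 1
  /-- `q` is supported in `(0, L + 2ℓ)`. -/
  support : ∀ t, q t ≠ 0 → t ∈ Set.Ioo 0 (L + 2 * ℓ)
  /-- Partition of unity `∑_m q(t - Lm)² = 1`. -/
  pu : ∀ t, ∑' m : ℤ, ENNReal.ofReal (q (t - L * m) ^ 2) = 1
  /-- Slope bound `|q'| ≤ D`. -/
  deriv_le : ∀ t, |deriv q t| ≤ D
  /-- `q'` lives on the ramps `[0, 2ℓ] ∪ [L, L + 2ℓ]`. -/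
  deriv_support : ∀ t, deriv q t ≠ 0 → t ∈ Set.Icc 0 (2 * ℓ) ∪ Set.Icc L (L + 2 * ℓ)

/-- `exists_smooth_cutoff`, repackaged: there is a universal `c ≥ 0` such that for `0 < ℓ`,
`2ℓ ≤ L` an admissible profile with slope bound `c/ℓ` exists. [cite: BastiCenatiempoSchlein2021, App. A, Lemma A.1] -/
theorem exists_isCutoffProfile : ∃ c : ℝ, 0 ≤ c ∧ ∀ ℓ L : ℝ, 0 < ℓ → 2 * ℓ ≤ L →
    ∃ q : ℝ → ℝ, IsCutoffProfile q ℓ L (c / ℓ) := by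
  obtain ⟨c, hc, h⟩ := exists_smooth_cutoff
  refine ⟨c, hc, fun ℓ L hℓ hℓL => ?_⟩
  obtain ⟨q, hq, hq01, hsupp, hpu, hD, hA⟩ := h ℓ L hℓ hℓL
  exact ⟨q, ⟨hq, hq01, hsupp, hpu, hD, hA⟩⟩

/-- The ramps carry the slope: `q' ≠ 0` only on a measurable set. [folklore] -/
theorem IsCutoffProfile.measurableSet_ramps (ℓ L : ℝ) :
    MeasurableSet (Set.Icc 0 (2 * ℓ) ∪ Set.Icc L (L + 2 * ℓ)) :=
  measurableSet_Icc.union measurableSet_Icc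

/-- **The cut-off state as a Dirichlet trial state** of the box `Λ_{L+2ℓ}` (`‖Ψ^D‖ = 1` of
Lemma A.1, by the partition of unity). [cite: BastiCenatiempoSchlein2021, App. A, Lemma A.1] -/
def cutoffTrialState {ℓ L D : ℝ} {q : ℝ → ℝ} (hL : 0 < L) (hq : IsCutoffProfile q ℓ L D)
    (Ψ : PeriodicTrialState N L) (u : Space) : TrialState N (L + 2 * ℓ) where
  ψ := cutoffFun q u Ψ.ψ
  contDiff := contDiff_cutoffState hq.contDiff Ψ.contDiff fun _ => u
  eq_zero X hX := by
    by_contra h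
    exact hX fun i => mem_box_of_cutoffState_ne_zero hq.support Ψ.ψ (fun _ => u) X h i
  symm σ X := cutoffState_comp_perm Ψ.symm u σ X
  norm_eq := lintegral_ennnorm_cutoffState_sq hL hq.contDiff.continuous (fun t => (hq.range t).1)
    hq.pu Ψ u

/-- The wave function of `cutoffTrialState` is `cutoffFun`. [folklore] -/
@[simp] theorem cutoffTrialState_ψ {ℓ L D : ℝ} {q : ℝ → ℝ} (hL : 0 < L)
    (hq : IsCutoffProfile q ℓ L D) (Ψ : PeriodicTrialState N L) (u : Space) :
    (cutoffTrialState hL hq Ψ u).ψ = cutoffFun q u Ψ.ψ := rfl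

/-- **Energy of the cut-off state for a fixed shift, with a Young parameter** — the bound
`energyIntegral_cutoffState_le_eta` for the named state: `⟨Φ_u, HΦ_u⟩ ≤ ⟨Ψ,HΨ⟩_per + ∑_{i,k}
∫_{cell} (η |∂_{ik}Ψ|² + (1 + η⁻¹) D² |Ψ|²) ρ_{ramps}(x_{ik} - u_k)`.
[cite: BastiCenatiempoSchlein2021, App. A, Lemma A.1 (A.2)–(A.5)] -/
theorem energy_cutoffTrialState_le_eta {v : ℝ → ℝ≥0∞} {ℓ L D : ℝ} {q : ℝ → ℝ} (hL : 0 < L)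
    (hvm : Measurable v) (hq : IsCutoffProfile q ℓ L D) {η : ℝ} (hη : 0 < η)
    (Ψ : PeriodicTrialState N L) (u : Space) :
    energy v (cutoffTrialState hL hq Ψ u) ≤
      periodicEnergy v Ψ +
        ∑ i : Fin N, ∑ k : Fin 3, ∫⁻ X in cellN N L,
          (ENNReal.ofReal η * ((‖fderiv ℝ Ψ.ψ X (Pi.single i (EuclideanSpace.single k (1 : ℝ)))‖₊ : ℝ≥0∞)) ^ 2 +
              (1 + ENNReal.ofReal η⁻¹) * ENNReal.ofReal (D ^ 2) * ((‖Ψ.ψ X‖₊ : ℝ≥0∞)) ^ 2) *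
            ∑' n : ℤ, (Set.Icc 0 (2 * ℓ) ∪ Set.Icc L (L + 2 * ℓ)).indicator (1 : ℝ → ℝ≥0∞)
              (X i k - u k - L * n) :=
  energyIntegral_cutoffState_le_eta hL hvm hq.contDiff hq.range hq.pu hq.deriv_le
    (IsCutoffProfile.measurableSet_ramps ℓ L) hq.deriv_support hη Ψ u

end Literature.MathematicalPhysics.QuantumManyBody.BoseGas

end
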